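import Summits.CriticalPhenomena.PercolationContinuityZ3.Theorems.PercNearOneGluingNoHeavyQuantLongTailTripleHubAlg
import HarnessLib

/-!
# QUANT lane R8, T-DEC: LONG-TAIL TRIPLE HUB BEYOND 3lo — closed forms of the TOP route, THE COST AT `6lo+2K` (census-1 gen 32)

builds on p205010 (kernel theorem, internal audit signed; external expert review pending)

Support file (`--supports stmt-CriticalPhenomena-4575`), QUANT lane seat prim-quant-census-1 (gen 32); memo
`run/shared/lean/prim/quant/prim-quant-census-1/g32/TWOLO-G32.md` §6 (iv); this file = the floor part of the top route's cost at the regime boundary `T = 6lo+2K` (companions `…TripleTopAlg`, `…TripleTopAlgTwo`).  Theorems only, standard axioms, no sorries.  Pure real-polynomial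
inequalities: the certificates of the TWO-BRANCH rule for the width-3 hub `S(γ₁)∗S(γ₂)∗S(γ₃)` of shape `{lo, lo+K; γ}` with `3lo < K ≤ 7lo/2`
(memo §6 (iv); exp39: 0 failures in 226 000 instances): the low `3lo` goes to `3lo+K` while the credit `(T−6lo)(u₀+u₁) ≤ K·u₁` lasts (floor capacity
`ltTriple_capMid`, cost free), and EVERYTHING charged goes to the top `3lo+3K` afterwards (`T = 6lo + D`; one low `3lo` for `D ≤ 2K`, two lows `3lo`,
`3lo+K` for `D > 2K`).  Notation: `u₀ = (1−g₁)(1−g₂)(1−g₃)`, `u₁ = Σ gᵢ(1−gⱼ)(1−gₖ)`, `u₂ = Σ gᵢgⱼ(1−gₖ)`, `u₃ = g₁g₂g₃`; rate `ρ = D/(3K)` for the low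
`3lo` (and `(D−2K)/(2K) ≤ D/(3K)` for `3lo+K`), budget `u₀(D+3lo) + u₁(D+3lo−K) + u₂(D+3lo−2K)₊`.  Certificates found by kit j296246 (`code/kitjob4`:
scipy/HiGHS float LP for the support + exact rational repair), checked here by `linarith` over explicit products of nonnegative atoms.
* `ltTop_capRho_one` / `ltTop_capRho_two` — ρ-capacity of the top: `D(u₀+u₃) ≤ 3Ku₃` (one low, needs the exhausted credit), `D(u₀+u₁+u₃) ≤ 3Ku₃` (two).
* `ltTop_costRho_oneA` / `ltTop_costRho_oneB` / `ltTop_costRho_two` — ρ-part of the torque cost `(3lo+3K−T)·ρ/(1−ρ)·flow ≤ budget`.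
* `ltTop_capTop_two` — floor capacity with two lows at the largest floor: `(lo+Kg₁)(u₀+u₁+u₃) ≤ (lo+K)u₃`.
* `ltTop_cost0_max` — the floor part of the cost at the switching point `τ = 6lo + K·u₁/(u₀+u₁)`, largest floor (degree 8).
ALSO HERE: `ltTop_cost2_max` (the floor cost at `T = 6lo+2K`, `Cc2`) and `ltTop_capTop_oneQ` (the one-low floor capacity under the THREE-branch premise).
CAVEAT (memo §6 (iv), exp41): under the exhausted credit ALONE the one-low floor capacity `(lo+Kg₁)(u₀+u₃) ≤ (lo+K)u₃` is FALSE at `lo/K = 2/7` (thin gate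
box [0.54, 0.565], `a = 1`) and true for `lo/K ≥ 0.29`: the two-branch rule is a theorem candidate for `K ≤ 10lo/3` only; beyond, the three-branch rule.

HONEST STATUS.  Algebra only; `SiblingStep`, `GluedDominatedMass`, `SDECConvClosed`, `FarTreeRow` OPEN; RATE class (log\*) / honest sentence of
`run/shared/lean/prim/quant/README.md` unchanged.  [this work].  Nothing here is cited as a published result.  The gluing rows served
[cite: KozmaNitzan2024, Conjecture 3 (p. 15)]; product measure [cite: Grimmett1999, §1.3 p. 10].
-/

noncomputable section

namespace Summit.CriticalPhenomena.PercolationContinuityZ3.Theorems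
namespace Quant
namespace LawDec

set_option maxRecDepth 4096 in
/-- **top cost, floor part, at `T = 6lo+2K`, largest floor** (`g₁` the least gate, `2K ≤ K(g₁+g₂+g₃) − 3lo`):
`(K−3lo)(lo+Kg₁)(6lo+2K)(u₀+u₁) ≤ ((3lo+K(g₁+g₂+g₃))(lo+K) − (lo+Kg₁)(6lo+2K))·(u₀(3lo+2K)+u₁(3lo+K)+3lo·u₂)`.  Degree-6 certificate,
120 products (kit j296261). [this work] -/
theorem ltTop_cost2_max (lo K g₁ g₂ g₃ : ℝ) (hlo : 0 < lo)
    (hK1 : 3 * lo ≤ K) (hK2 : 2 * K ≤ 7 * lo) (hg₁ : lo ≤ K * g₁) (hg₂ : lo ≤ K * g₂) (hg₃ : lo ≤ K * g₃) (h12 : g₁ ≤ g₂)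
    (h13 : g₁ ≤ g₃) (h11 : g₁ ≤ 1) (h21 : g₂ ≤ 1) (h31 : g₃ ≤ 1) (hL2' : 2 * K ≤ K * (g₁ + g₂ + g₃) - 3 * lo) :
    (K - 3 * lo) * (lo + K * g₁) * (6 * lo + 2 * K) * ((1 - g₁) * (1 - g₂) * (1 - g₃) + (g₁ * (1 - g₂) * (1 - g₃) + g₂ * (1 - g₁) * (1 - g₃)
          + g₃ * (1 - g₁) * (1 - g₂)))
      ≤ ((3 * lo + K * (g₁ + g₂ + g₃)) * (lo + K) - (lo + K * g₁) * (6 * lo + 2 * K)) * ((1 - g₁) * (1 - g₂) * (1 - g₃) * (3 * lo + 2 * K) + (g₁ * (1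
          - g₂) * (1 - g₃) + g₂ * (1 - g₁) * (1 - g₃) + g₃ * (1 - g₁) * (1 - g₂)) * (3 * lo + K) + (g₁ * g₂ * (1 - g₃) + g₁ * g₃ * (1 - g₂) + g₂ * g₃ * (1 - g₁)) * (3 * lo)) := by
  have hK : 0 < K := by linarith
  have hA1 : 0 ≤ K * g₁ - lo := sub_nonneg.2 hg₁
  have hA2 : 0 ≤ K * g₂ - lo := sub_nonneg.2 hg₂
  have hA3 : 0 ≤ K * g₃ - lo := sub_nonneg.2 hg₃
  have hE1 : 0 ≤ 1 - g₁ := sub_nonneg.2 h11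
  have hE2 : 0 ≤ 1 - g₂ := sub_nonneg.2 h21
  have hE3 : 0 ≤ 1 - g₃ := sub_nonneg.2 h31
  have h21' : 0 ≤ g₂ - g₁ := sub_nonneg.2 h12
  have h31' : 0 ≤ g₃ - g₁ := sub_nonneg.2 h13
  have hClo : 0 ≤ 7 * lo - 2 * K := by linarith
  have hChi : 0 ≤ K - 3 * lo := by linarith
  have hL2 : 0 ≤ K * (g₁ + g₂ + g₃) - 3 * lo - 2 * K := by linarith
  have key : 0 ≤ K * (((3 * lo + K * (g₁ + g₂ + g₃)) * (lo + K) - (lo + K * g₁) * (6 * lo + 2 * K)) * ((1 - g₁) * (1 - g₂) * (1 - g₃) * (3 * lo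
          + 2 * K) + (g₁ * (1 - g₂) * (1 - g₃) + g₂ * (1 - g₁) * (1 - g₃) + g₃ * (1 - g₁) * (1 - g₂)) * (3 * lo + K) + (g₁ * g₂ * (1
          - g₃) + g₁ * g₃ * (1 - g₂) + g₂ * g₃ * (1 - g₁)) * (3 * lo))
      - ((K - 3 * lo) * (lo + K * g₁) * (6 * lo + 2 * K) * ((1 - g₁) * (1 - g₂) * (1 - g₃) + (g₁ * (1 - g₂) * (1 - g₃) + g₂ * (1 - g₁) * (1 - g₃)
          + g₃ * (1 - g₁) * (1 - g₂))))) := by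
    linarith [mul_nonneg (mul_nonneg (mul_nonneg (mul_nonneg h31' hA2) hL2) hL2) hL2,
      mul_nonneg (mul_nonneg (mul_nonneg (mul_nonneg h31' hClo) hL2) hL2) hK.le,
      mul_nonneg (mul_nonneg (mul_nonneg (mul_nonneg (mul_nonneg (mul_nonneg (mul_nonneg (mul_nonneg h31' h31') h31') h31') h31') hK.le) hK.le) hK.le) hK.le,
      mul_nonneg (mul_nonneg (mul_nonneg (mul_nonneg h21' hA3) hL2) hL2) hL2,
      mul_nonneg (mul_nonneg (mul_nonneg (mul_nonneg h21' hClo) hL2) hL2) hK.le,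
      mul_nonneg (mul_nonneg (mul_nonneg (mul_nonneg (mul_nonneg (mul_nonneg (mul_nonneg (mul_nonneg h21' h21') h21') h21') h21') hK.le) hK.le) hK.le) hK.le,
      mul_nonneg (mul_nonneg (mul_nonneg (mul_nonneg hE3 hL2) hK.le) hK.le) hK.le,
      mul_nonneg (mul_nonneg (mul_nonneg (mul_nonneg hE3 hL2) hL2) hL2) hL2,
      mul_nonneg (mul_nonneg (mul_nonneg (mul_nonneg hE3 hChi) hK.le) hK.le) hK.le,
      mul_nonneg (mul_nonneg (mul_nonneg (mul_nonneg hE3 hClo) hChi) hK.le) hK.le,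
      mul_nonneg (mul_nonneg (mul_nonneg (mul_nonneg hE3 hClo) hClo) hA2) hL2,
      mul_nonneg (mul_nonneg (mul_nonneg (mul_nonneg hE3 hClo) hClo) hChi) hK.le,
      mul_nonneg (mul_nonneg (mul_nonneg (mul_nonneg (mul_nonneg hE3 h31') hA3) hK.le) hK.le) hK.le,
      mul_nonneg (mul_nonneg (mul_nonneg (mul_nonneg (mul_nonneg hE3 h31') hClo) hK.le) hK.le) hK.le,
      mul_nonneg (mul_nonneg (mul_nonneg (mul_nonneg (mul_nonneg (mul_nonneg (mul_nonneg hE3 h31') h31') h31') hL2) hK.le) hK.le) hK.le,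
      mul_nonneg (mul_nonneg (mul_nonneg (mul_nonneg (mul_nonneg hE3 h21') hA2) hK.le) hK.le) hK.le,
      mul_nonneg (mul_nonneg (mul_nonneg (mul_nonneg (mul_nonneg hE3 h21') hA2) hA2) hK.le) hK.le,
      mul_nonneg (mul_nonneg (mul_nonneg (mul_nonneg (mul_nonneg hE3 h21') hA2) hA2) hA3) hK.le,
      mul_nonneg (mul_nonneg (mul_nonneg (mul_nonneg (mul_nonneg (mul_nonneg hE3 h21') h21') hL2) hL2) hK.le) hK.le,
      mul_nonneg (mul_nonneg (mul_nonneg (mul_nonneg (mul_nonneg (mul_nonneg hE3 h21') h21') hA3) hA3) hK.le) hK.le,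
      mul_nonneg (mul_nonneg (mul_nonneg (mul_nonneg (mul_nonneg hE3 hE3) hA3) hA3) hL2) hK.le,
      mul_nonneg (mul_nonneg (mul_nonneg (mul_nonneg (mul_nonneg (mul_nonneg hE3 hE3) h21') hL2) hL2) hK.le) hK.le,
      mul_nonneg (mul_nonneg (mul_nonneg (mul_nonneg (mul_nonneg (mul_nonneg hE3 hE3) hE3) hA3) hK.le) hK.le) hK.le,
      mul_nonneg (mul_nonneg (mul_nonneg (mul_nonneg (mul_nonneg (mul_nonneg (mul_nonneg hE3 hE3) hE3) hE3) hChi) hK.le) hK.le) hK.le,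
      mul_nonneg (mul_nonneg (mul_nonneg (mul_nonneg hE2 hL2) hK.le) hK.le) hK.le,
      mul_nonneg (mul_nonneg (mul_nonneg (mul_nonneg hE2 hL2) hL2) hL2) hL2,
      mul_nonneg (mul_nonneg (mul_nonneg (mul_nonneg hE2 hChi) hK.le) hK.le) hK.le,
      mul_nonneg (mul_nonneg (mul_nonneg (mul_nonneg hE2 hClo) hChi) hK.le) hK.le,
      mul_nonneg (mul_nonneg (mul_nonneg (mul_nonneg hE2 hClo) hClo) hA3) hL2,
      mul_nonneg (mul_nonneg (mul_nonneg (mul_nonneg hE2 hClo) hClo) hChi) hK.le,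
      mul_nonneg (mul_nonneg (mul_nonneg (mul_nonneg (mul_nonneg hE2 h31') hL2) hK.le) hK.le) hK.le,
      mul_nonneg (mul_nonneg (mul_nonneg (mul_nonneg (mul_nonneg hE2 h31') hA3) hK.le) hK.le) hK.le,
      mul_nonneg (mul_nonneg (mul_nonneg (mul_nonneg (mul_nonneg hE2 h31') hA3) hA3) hK.le) hK.le,
      mul_nonneg (mul_nonneg (mul_nonneg (mul_nonneg (mul_nonneg hE2 h31') hA2) hA3) hA3) hK.le,
      mul_nonneg (mul_nonneg (mul_nonneg (mul_nonneg (mul_nonneg (mul_nonneg hE2 h31') h31') hL2) hL2) hK.le) hK.le,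
      mul_nonneg (mul_nonneg (mul_nonneg (mul_nonneg (mul_nonneg (mul_nonneg hE2 h31') h31') hA2) hA2) hK.le) hK.le,
      mul_nonneg (mul_nonneg (mul_nonneg (mul_nonneg (mul_nonneg hE2 h21') hA2) hK.le) hK.le) hK.le,
      mul_nonneg (mul_nonneg (mul_nonneg (mul_nonneg (mul_nonneg hE2 h21') hClo) hK.le) hK.le) hK.le,
      mul_nonneg (mul_nonneg (mul_nonneg (mul_nonneg (mul_nonneg (mul_nonneg (mul_nonneg hE2 h21') h21') h21') hL2) hK.le) hK.le) hK.le,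
      mul_nonneg (mul_nonneg (mul_nonneg (mul_nonneg (mul_nonneg hE2 hE3) hChi) hL2) hK.le) hK.le,
      mul_nonneg (mul_nonneg (mul_nonneg (mul_nonneg (mul_nonneg hE2 hE3) hClo) hK.le) hK.le) hK.le,
      mul_nonneg (mul_nonneg (mul_nonneg (mul_nonneg (mul_nonneg hE2 hE3) hClo) hChi) hL2) hK.le,
      mul_nonneg (mul_nonneg (mul_nonneg (mul_nonneg (mul_nonneg hE2 hE3) hClo) hClo) hK.le) hK.le,
      mul_nonneg (mul_nonneg (mul_nonneg (mul_nonneg (mul_nonneg hE2 hE3) hClo) hClo) hClo) hK.le,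
      mul_nonneg (mul_nonneg (mul_nonneg (mul_nonneg (mul_nonneg (mul_nonneg hE2 hE3) hE3) hL2) hK.le) hK.le) hK.le,
      mul_nonneg (mul_nonneg (mul_nonneg (mul_nonneg (mul_nonneg hE2 hE2) hA2) hA2) hL2) hK.le,
      mul_nonneg (mul_nonneg (mul_nonneg (mul_nonneg (mul_nonneg (mul_nonneg hE2 hE2) h31') hL2) hL2) hK.le) hK.le,
      mul_nonneg (mul_nonneg (mul_nonneg (mul_nonneg (mul_nonneg (mul_nonneg hE2 hE2) hE2) hK.le) hK.le) hK.le) hK.le,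
      mul_nonneg (mul_nonneg (mul_nonneg (mul_nonneg (mul_nonneg (mul_nonneg hE2 hE2) hE2) hA2) hK.le) hK.le) hK.le,
      mul_nonneg (mul_nonneg (mul_nonneg (mul_nonneg (mul_nonneg (mul_nonneg (mul_nonneg hE2 hE2) hE2) hE2) hChi) hK.le) hK.le) hK.le,
      mul_nonneg (mul_nonneg (mul_nonneg (mul_nonneg hE1 hL2) hL2) hL2) hL2,
      mul_nonneg (mul_nonneg (mul_nonneg (mul_nonneg hE1 hChi) hK.le) hK.le) hK.le,
      mul_nonneg (mul_nonneg (mul_nonneg (mul_nonneg hE1 hClo) hChi) hK.le) hK.le,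
      mul_nonneg (mul_nonneg (mul_nonneg (mul_nonneg hE1 hClo) hClo) hChi) hK.le,
      mul_nonneg (mul_nonneg (mul_nonneg (mul_nonneg hE1 hClo) hClo) hClo) hChi,
      mul_nonneg (mul_nonneg (mul_nonneg (mul_nonneg (mul_nonneg hE1 h31') hL2) hK.le) hK.le) hK.le,
      mul_nonneg (mul_nonneg (mul_nonneg (mul_nonneg (mul_nonneg (mul_nonneg hE1 h31') h31') hChi) hL2) hK.le) hK.le,
      mul_nonneg (mul_nonneg (mul_nonneg (mul_nonneg (mul_nonneg (mul_nonneg hE1 h31') h31') hClo) hK.le) hK.le) hK.le,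
      mul_nonneg (mul_nonneg (mul_nonneg (mul_nonneg (mul_nonneg (mul_nonneg hE1 h31') h31') hClo) hClo) hK.le) hK.le,
      mul_nonneg (mul_nonneg (mul_nonneg (mul_nonneg (mul_nonneg hE1 h21') hL2) hK.le) hK.le) hK.le,
      mul_nonneg (mul_nonneg (mul_nonneg (mul_nonneg (mul_nonneg (mul_nonneg hE1 h21') h21') hK.le) hK.le) hK.le) hK.le,
      mul_nonneg (mul_nonneg (mul_nonneg (mul_nonneg (mul_nonneg (mul_nonneg hE1 h21') h21') hChi) hL2) hK.le) hK.le,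
      mul_nonneg (mul_nonneg (mul_nonneg (mul_nonneg (mul_nonneg (mul_nonneg hE1 h21') h21') hClo) hK.le) hK.le) hK.le,
      mul_nonneg (mul_nonneg (mul_nonneg (mul_nonneg (mul_nonneg (mul_nonneg hE1 h21') h21') hClo) hClo) hK.le) hK.le,
      mul_nonneg (mul_nonneg (mul_nonneg (mul_nonneg (mul_nonneg hE1 hE3) hK.le) hK.le) hK.le) hK.le,
      mul_nonneg (mul_nonneg (mul_nonneg (mul_nonneg (mul_nonneg hE1 hE3) hClo) hK.le) hK.le) hK.le,
      mul_nonneg (mul_nonneg (mul_nonneg (mul_nonneg (mul_nonneg hE1 hE3) hClo) hClo) hK.le) hK.le,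
      mul_nonneg (mul_nonneg (mul_nonneg (mul_nonneg (mul_nonneg hE1 hE3) hClo) hClo) hClo) hK.le,
      mul_nonneg (mul_nonneg (mul_nonneg (mul_nonneg (mul_nonneg (mul_nonneg (mul_nonneg hE1 hE3) h31') h31') hL2) hK.le) hK.le) hK.le,
      mul_nonneg (mul_nonneg (mul_nonneg (mul_nonneg (mul_nonneg (mul_nonneg hE1 hE3) h21') hL2) hL2) hK.le) hK.le,
      mul_nonneg (mul_nonneg (mul_nonneg (mul_nonneg (mul_nonneg (mul_nonneg (mul_nonneg hE1 hE3) hE3) h31') hK.le) hK.le) hK.le) hK.le,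
      mul_nonneg (mul_nonneg (mul_nonneg (mul_nonneg (mul_nonneg (mul_nonneg (mul_nonneg hE1 hE3) hE3) h31') hClo) hK.le) hK.le) hK.le,
      mul_nonneg (mul_nonneg (mul_nonneg (mul_nonneg (mul_nonneg hE1 hE2) hK.le) hK.le) hK.le) hK.le,
      mul_nonneg (mul_nonneg (mul_nonneg (mul_nonneg (mul_nonneg hE1 hE2) hClo) hK.le) hK.le) hK.le,
      mul_nonneg (mul_nonneg (mul_nonneg (mul_nonneg (mul_nonneg hE1 hE2) hClo) hClo) hK.le) hK.le,
      mul_nonneg (mul_nonneg (mul_nonneg (mul_nonneg (mul_nonneg hE1 hE2) hClo) hClo) hClo) hK.le,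
      mul_nonneg (mul_nonneg (mul_nonneg (mul_nonneg (mul_nonneg (mul_nonneg hE1 hE2) h31') hL2) hL2) hK.le) hK.le,
      mul_nonneg (mul_nonneg (mul_nonneg (mul_nonneg (mul_nonneg (mul_nonneg (mul_nonneg hE1 hE2) h21') h21') hL2) hK.le) hK.le) hK.le,
      mul_nonneg (mul_nonneg (mul_nonneg (mul_nonneg (mul_nonneg (mul_nonneg hE1 hE2) hE3) hL2) hK.le) hK.le) hK.le,
      mul_nonneg (mul_nonneg (mul_nonneg (mul_nonneg (mul_nonneg (mul_nonneg hE1 hE2) hE3) hChi) hK.le) hK.le) hK.le,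
      mul_nonneg (mul_nonneg (mul_nonneg (mul_nonneg (mul_nonneg (mul_nonneg hE1 hE2) hE3) hClo) hL2) hK.le) hK.le,
      mul_nonneg (mul_nonneg (mul_nonneg (mul_nonneg (mul_nonneg (mul_nonneg hE1 hE2) hE3) hClo) hChi) hK.le) hK.le,
      mul_nonneg (mul_nonneg (mul_nonneg (mul_nonneg (mul_nonneg (mul_nonneg hE1 hE2) hE3) hClo) hClo) hL2) hK.le,
      mul_nonneg (mul_nonneg (mul_nonneg (mul_nonneg (mul_nonneg (mul_nonneg hE1 hE2) hE3) hClo) hClo) hChi) hK.le,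
      mul_nonneg (mul_nonneg (mul_nonneg (mul_nonneg (mul_nonneg (mul_nonneg (mul_nonneg hE1 hE2) hE2) h21') hK.le) hK.le) hK.le) hK.le,
      mul_nonneg (mul_nonneg (mul_nonneg (mul_nonneg (mul_nonneg (mul_nonneg (mul_nonneg hE1 hE2) hE2) h21') hClo) hK.le) hK.le) hK.le,
      mul_nonneg (mul_nonneg (mul_nonneg (mul_nonneg (mul_nonneg (mul_nonneg (mul_nonneg (mul_nonneg hE1 hE2) hE2) hE2) hE2) hK.le) hK.le) hK.le) hK.le,
      mul_nonneg (mul_nonneg (mul_nonneg (mul_nonneg (mul_nonneg hE1 hE1) hK.le) hK.le) hK.le) hK.le,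
      mul_nonneg (mul_nonneg (mul_nonneg (mul_nonneg (mul_nonneg hE1 hE1) hL2) hL2) hL2) hK.le,
      mul_nonneg (mul_nonneg (mul_nonneg (mul_nonneg (mul_nonneg hE1 hE1) hA3) hK.le) hK.le) hK.le,
      mul_nonneg (mul_nonneg (mul_nonneg (mul_nonneg (mul_nonneg hE1 hE1) hChi) hL2) hL2) hK.le,
      mul_nonneg (mul_nonneg (mul_nonneg (mul_nonneg (mul_nonneg hE1 hE1) hClo) hK.le) hK.le) hK.le,
      mul_nonneg (mul_nonneg (mul_nonneg (mul_nonneg (mul_nonneg hE1 hE1) hClo) hClo) hK.le) hK.le,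
      mul_nonneg (mul_nonneg (mul_nonneg (mul_nonneg (mul_nonneg (mul_nonneg hE1 hE1) hE3) hA2) hL2) hK.le) hK.le,
      mul_nonneg (mul_nonneg (mul_nonneg (mul_nonneg (mul_nonneg (mul_nonneg hE1 hE1) hE3) hChi) hK.le) hK.le) hK.le,
      mul_nonneg (mul_nonneg (mul_nonneg (mul_nonneg (mul_nonneg (mul_nonneg hE1 hE1) hE3) hClo) hChi) hK.le) hK.le,
      mul_nonneg (mul_nonneg (mul_nonneg (mul_nonneg (mul_nonneg (mul_nonneg hE1 hE1) hE2) hA3) hL2) hK.le) hK.le,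
      mul_nonneg (mul_nonneg (mul_nonneg (mul_nonneg (mul_nonneg (mul_nonneg hE1 hE1) hE2) hChi) hK.le) hK.le) hK.le,
      mul_nonneg (mul_nonneg (mul_nonneg (mul_nonneg (mul_nonneg (mul_nonneg hE1 hE1) hE2) hClo) hChi) hK.le) hK.le,
      mul_nonneg (mul_nonneg (mul_nonneg (mul_nonneg (mul_nonneg (mul_nonneg (mul_nonneg hE1 hE1) hE2) hE3) hK.le) hK.le) hK.le) hK.le,
      mul_nonneg (mul_nonneg (mul_nonneg (mul_nonneg (mul_nonneg (mul_nonneg (mul_nonneg hE1 hE1) hE2) hE3) hClo) hK.le) hK.le) hK.le,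
      mul_nonneg (mul_nonneg (mul_nonneg (mul_nonneg (mul_nonneg (mul_nonneg (mul_nonneg hE1 hE1) hE2) hE3) hClo) hClo) hK.le) hK.le,
      mul_nonneg (mul_nonneg (mul_nonneg (mul_nonneg (mul_nonneg (mul_nonneg (mul_nonneg hE1 hE1) hE1) h31') hL2) hK.le) hK.le) hK.le,
      mul_nonneg (mul_nonneg (mul_nonneg (mul_nonneg (mul_nonneg (mul_nonneg (mul_nonneg (mul_nonneg hE1 hE1) hE1) h31') h31') hK.le) hK.le) hK.le) hK.le,
      mul_nonneg (mul_nonneg (mul_nonneg (mul_nonneg (mul_nonneg (mul_nonneg (mul_nonneg hE1 hE1) hE1) h21') hL2) hK.le) hK.le) hK.le,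
      mul_nonneg (mul_nonneg (mul_nonneg (mul_nonneg (mul_nonneg (mul_nonneg (mul_nonneg (mul_nonneg hE1 hE1) hE1) h21') h21') hK.le) hK.le) hK.le) hK.le,
      mul_nonneg (mul_nonneg (mul_nonneg (mul_nonneg (mul_nonneg (mul_nonneg (mul_nonneg hE1 hE1) hE1) hE3) hK.le) hK.le) hK.le) hK.le,
      mul_nonneg (mul_nonneg (mul_nonneg (mul_nonneg (mul_nonneg (mul_nonneg (mul_nonneg hE1 hE1) hE1) hE3) hClo) hK.le) hK.le) hK.le,
      mul_nonneg (mul_nonneg (mul_nonneg (mul_nonneg (mul_nonneg (mul_nonneg (mul_nonneg hE1 hE1) hE1) hE2) hK.le) hK.le) hK.le) hK.le,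
      mul_nonneg (mul_nonneg (mul_nonneg (mul_nonneg (mul_nonneg (mul_nonneg (mul_nonneg hE1 hE1) hE1) hE2) hClo) hK.le) hK.le) hK.le,
      mul_nonneg (mul_nonneg (mul_nonneg (mul_nonneg hA1 h31') hL2) hL2) hK.le,
      mul_nonneg (mul_nonneg (mul_nonneg (mul_nonneg hA1 h31') hA3) hA3) hL2,
      mul_nonneg (mul_nonneg (mul_nonneg (mul_nonneg (mul_nonneg hA1 h31') h31') hL2) hK.le) hK.le,
      mul_nonneg (mul_nonneg (mul_nonneg (mul_nonneg hA1 h21') hL2) hL2) hK.le,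
      mul_nonneg (mul_nonneg (mul_nonneg (mul_nonneg hA1 h21') hA2) hA2) hL2,
      mul_nonneg (mul_nonneg (mul_nonneg (mul_nonneg (mul_nonneg hA1 h21') h21') hL2) hK.le) hK.le,
      mul_nonneg (mul_nonneg (mul_nonneg (mul_nonneg (mul_nonneg hA1 hE1) hE2) hK.le) hK.le) hK.le,
      mul_nonneg (mul_nonneg (mul_nonneg (mul_nonneg hA1 hA1) h31') hL2) hL2,
      mul_nonneg (mul_nonneg (mul_nonneg (mul_nonneg hA1 hA1) h21') hL2) hL2,
      mul_nonneg (mul_nonneg (mul_nonneg (mul_nonneg hA1 hA1) hE1) hL2) hL2]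
  by_contra hc; push Not at hc
  have := mul_neg_of_pos_of_neg hK (show ((3 * lo + K * (g₁ + g₂ + g₃)) * (lo + K) - (lo + K * g₁) * (6 * lo + 2 * K)) * ((1 - g₁) * (1 - g₂) * (1
          - g₃) * (3 * lo + 2 * K) + (g₁ * (1 - g₂) * (1 - g₃) + g₂ * (1 - g₁) * (1 - g₃) + g₃ * (1 - g₁) * (1 - g₂)) * (3 * lo + K) + (g₁ * g₂ * (1
          - g₃) + g₁ * g₃ * (1 - g₂) + g₂ * g₃ * (1 - g₁)) * (3 * lo)) - ((K - 3 * lo) * (lo + K * g₁) * (6 * lo + 2 * K) * ((1 - g₁) * (1 - g₂) * (1 - g₃) + (g₁ * (1 - g₂) * (1 - g₃) + g₂ * (1 - g₁) * (1 - g₃) + g₃ * (1 - g₁) * (1 - g₂)))) < 0 by linarith)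
  linarith

/-- **top capacity, floor part, one low, at the largest floor, THREE-BRANCH premise** (`g₁` the least gate, `3lo ≤ K`, `2K ≤ 7lo`; the credit
AND the `3lo+2K` capacity exhausted at `a = 1`): `(lo+Kg₁)(u₀+u₃) ≤ (lo+K)u₃`.  Degree-4 certificate, 32 products (kit j296606).  (Under the credit premise alone
this is FALSE at `lo/K = 2/7` — memo §6 (iv); true for `lo/K ≥ 0.29`, uncertified.) [this work] -/
theorem ltTop_capTop_oneQ (lo K g₁ g₂ g₃ : ℝ) (hlo : 0 < lo)
    (hK1 : 3 * lo ≤ K) (hK2 : 2 * K ≤ 7 * lo) (hg₁ : lo ≤ K * g₁) (hg₂ : lo ≤ K * g₂) (hg₃ : lo ≤ K * g₃) (h12 : g₁ ≤ g₂)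
    (h13 : g₁ ≤ g₃) (h11 : g₁ ≤ 1) (h21 : g₂ ≤ 1) (h31 : g₃ ≤ 1)
    (hcr0 : K * (g₁ * (1 - g₂) * (1 - g₃) + g₂ * (1 - g₁) * (1 - g₃) + g₃ * (1 - g₁) * (1 - g₂))
      ≤ (K * (g₁ + g₂ + g₃) - 3 * lo) * ((1 - g₁) * (1 - g₂) * (1 - g₃) + (g₁ * (1 - g₂) * (1 - g₃) + g₂ * (1 - g₁) * (1 - g₃) + g₃ * (1 - g₁) * (1
          - g₂))))
    (hcap2 : 2 * K * (g₁ * g₂ * (1 - g₃) + g₁ * g₃ * (1 - g₂) + g₂ * g₃ * (1 - g₁))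
      ≤ (K * (g₁ + g₂ + g₃) - 3 * lo) * ((1 - g₁) * (1 - g₂) * (1 - g₃) + (g₁ * g₂ * (1 - g₃) + g₁ * g₃ * (1 - g₂) + g₂ * g₃ * (1 - g₁)))) :
    (lo + K * g₁) * ((1 - g₁) * (1 - g₂) * (1 - g₃) + (g₁ * g₂ * g₃))
      ≤ (lo + K) * (g₁ * g₂ * g₃) := by
  have hK : 0 < K := by linarith
  have hA1 : 0 ≤ K * g₁ - lo := sub_nonneg.2 hg₁
  have hA2 : 0 ≤ K * g₂ - lo := sub_nonneg.2 hg₂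
  have hA3 : 0 ≤ K * g₃ - lo := sub_nonneg.2 hg₃
  have hE1 : 0 ≤ 1 - g₁ := sub_nonneg.2 h11
  have hE2 : 0 ≤ 1 - g₂ := sub_nonneg.2 h21
  have hE3 : 0 ≤ 1 - g₃ := sub_nonneg.2 h31
  have h21' : 0 ≤ g₂ - g₁ := sub_nonneg.2 h12
  have h31' : 0 ≤ g₃ - g₁ := sub_nonneg.2 h13
  have hClo : 0 ≤ 7 * lo - 2 * K := by linarith
  have hChi : 0 ≤ K - 3 * lo := by linarith
  have hP0 : 0 ≤ (K * (g₁ + g₂ + g₃) - 3 * lo) * ((1 - g₁) * (1 - g₂) * (1 - g₃) + (g₁ * (1 - g₂) * (1 - g₃) + g₂ * (1 - g₁) * (1 - g₃) + g₃ * (1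
          - g₁) * (1 - g₂))) - K * (g₁ * (1 - g₂) * (1 - g₃) + g₂ * (1 - g₁) * (1 - g₃) + g₃ * (1 - g₁) * (1 - g₂)) := sub_nonneg.2 hcr0
  have hQ0 : 0 ≤ (K * (g₁ + g₂ + g₃) - 3 * lo) * ((1 - g₁) * (1 - g₂) * (1 - g₃) + (g₁ * g₂ * (1 - g₃) + g₁ * g₃ * (1 - g₂) + g₂ * g₃ * (1
          - g₁))) - 2 * K * (g₁ * g₂ * (1 - g₃) + g₁ * g₃ * (1 - g₂) + g₂ * g₃ * (1 - g₁)) := sub_nonneg.2 hcap2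
  have key : 0 ≤ K * ((lo + K) * (g₁ * g₂ * g₃)
      - ((lo + K * g₁) * ((1 - g₁) * (1 - g₂) * (1 - g₃) + (g₁ * g₂ * g₃)))) := by
    linarith [mul_nonneg hP0 hK.le,
      mul_nonneg hQ0 hK.le,
      mul_nonneg (mul_nonneg h31' hA3) hK.le,
      mul_nonneg (mul_nonneg h31' hA2) hA2,
      mul_nonneg (mul_nonneg (mul_nonneg h31' h31') hK.le) hK.le,
      mul_nonneg (mul_nonneg h21' hK.le) hK.le,
      mul_nonneg (mul_nonneg h21' hA2) hK.le,
      mul_nonneg (mul_nonneg hE3 hClo) hK.le,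
      mul_nonneg (mul_nonneg (mul_nonneg (mul_nonneg hE3 hE3) h21') hK.le) hK.le,
      mul_nonneg (mul_nonneg hE2 hClo) hK.le,
      mul_nonneg (mul_nonneg hE2 hClo) hA3,
      mul_nonneg (mul_nonneg (mul_nonneg (mul_nonneg hE2 hE2) h31') hK.le) hK.le,
      mul_nonneg (mul_nonneg hE1 hP0) hK.le,
      mul_nonneg (mul_nonneg hE1 hQ0) hK.le,
      mul_nonneg (mul_nonneg hE1 hA3) hA3,
      mul_nonneg (mul_nonneg hE1 hA2) hA2,
      mul_nonneg (mul_nonneg hE1 hClo) hK.le,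
      mul_nonneg (mul_nonneg hE1 hClo) hA3,
      mul_nonneg (mul_nonneg hE1 hClo) hA2,
      mul_nonneg (mul_nonneg (mul_nonneg (mul_nonneg hE1 hE3) h21') hK.le) hK.le,
      mul_nonneg (mul_nonneg (mul_nonneg (mul_nonneg hE1 hE2) h31') hK.le) hK.le,
      mul_nonneg (mul_nonneg (mul_nonneg (mul_nonneg hE1 hE2) hE3) hChi) hK.le,
      mul_nonneg (mul_nonneg (mul_nonneg (mul_nonneg (mul_nonneg hE1 hE2) hE3) hE3) hK.le) hK.le,
      mul_nonneg (mul_nonneg (mul_nonneg (mul_nonneg (mul_nonneg hE1 hE2) hE2) hE3) hK.le) hK.le,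
      mul_nonneg (mul_nonneg (mul_nonneg (mul_nonneg (mul_nonneg hE1 hE1) hE2) hE3) hK.le) hK.le,
      mul_nonneg (mul_nonneg hA1 hE2) hClo,
      mul_nonneg (mul_nonneg hA1 hE1) hA3,
      mul_nonneg (mul_nonneg hA1 hE1) hA2,
      mul_nonneg (mul_nonneg hA1 hE1) hClo,
      mul_nonneg (mul_nonneg hA1 hA1) hE3,
      mul_nonneg (mul_nonneg hA1 hA1) hE2,
      mul_nonneg (mul_nonneg hA1 hA1) hE1]
  by_contra hc; push Not at hc
  have := mul_neg_of_pos_of_neg hK (show (lo + K) * (g₁ * g₂ * g₃) - ((lo + K * g₁) * ((1 - g₁) * (1 - g₂) * (1 - g₃)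
          + (g₁ * g₂ * g₃))) < 0 by linarith)
  linarith

end LawDec
end Quant
end Summit.CriticalPhenomena.PercolationContinuityZ3.Theorems
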